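import Mathlib.Topology.MetricSpace.Congruence
import Mathlib.Analysis.InnerProductSpace.Projection.FiniteDimensional
import Mathlib.Tactic.Module
import Literature.Barriers.AtomisticToContinuum.StickySphereClusters
import HarnessLib

/-!
# Proof of the named fact `ArkusHoy_sixSpheres` (six sticky spheres: `N_c^max(6) = 12`, `M(6,12) = 2`)

This file discharges the named fact
`Literature.Barriers.AtomisticToContinuum.ArkusHoy_sixSpheres` of
`Literature/Barriers/AtomisticToContinuum/StickySphereClusters.lean`
(`ArkusHoy_sixSpheres_holds`, at the end of the file): for six distinct points of `ℝ³` forming a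
packing of unit balls in which every ball has at least three contacts, the number of contacts
(pairs at distance exactly `2`) is at most `12`, and it equals `12` only for clusters congruent up
to relabelling to the regular octahedron `octahedralSix` or to the capped trigonal bipyramid
`cappedBipyramidSix`.

## Source and what is printed

Hoy–Harwayne-Gidansky–O'Hern, *Structure of finite sphere packings via exact enumeration*,
Phys. Rev. E 85 (2012) 051403, §II (p. 4): "`𝓜(6,12) = 2` since exactly two six-particle
macrostates exist for systems with `N_c = N_c^max(6) = 12` (Fig. 1) [hoare76]"; the two
macrostates are the octahedron (Fig. 1(a)) and the capped trigonal bipyramid (Fig. 1(b)). The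
paper obtains this by exact enumeration of adjacency matrices filtered by geometric rejection
rules (§II B, after Arkus–Manoharan–Brenner 2009) and a structure solver (§II D); no
pen-and-paper proof is printed. The proof below is an independent, elementary one and uses
neither the packing hypothesis nor the three-contacts-per-ball hypothesis of the fact (both are
consequences for `12` contacts).

## The proof

Write "contact" for a pair at distance `2`; `M` is the set of non-contact pairs `i < j`, so that
`contactNumber z + #M = 15`.

* *No `K₅`* (`no_five_pairwise_dist_two`, in the imported file): every label is avoided by some
  non-contact pair. Hence `M ≠ ∅`; pick `p ∈ M` and `q ∈ M` avoiding `p.1`.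
* *Inner-product toolkit in `ℝ³`*: polarisation `⟪a - b, c - d⟫` from four distances
  (`inner_sub_sub_eq_dist`); a `2 × 2` Gram criterion for independence; "orthogonal to three
  independent vectors ⇒ zero" by a dimension count (`eq_zero_of_inner_three`); two vectors
  orthogonal to an independent pair are parallel (`exists_smul_of_inner_eq_zero`).
* *Reflection lemma* (`cap_point`): two distinct points at distance `2` from the vertices of an
  equilateral triangle of side `2` satisfy `y + y' = (2/3)(p₁ + p₂ + p₃)` and `|yy'|² = 32/3`.
* *Three spheres* (`three_spheres`): no three distinct points are at distance `2` from three
  non-collinear points.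
* *The five labelled patterns*: complement a triangle (`tri_absurd`, impossible), a path plus an
  edge (`p3p2_absurd`, impossible), inside two disjoint pairs (`twoK2_absurd`, impossible: two
  caps over adjacent faces of a regular tetrahedron are `10/3` apart), a perfect matching
  (`octa_sq_dists`: the three axes are pairwise orthogonal with a common midpoint, all of squared
  length `8`), a path with three edges (`ctb_dists`: `|04|² = |15|² = 32/3`, `|05| = 10/3`); the
  last two give label-by-label equality of all distances with `octahedralSix`,
  `cappedBipyramidSix` (`dist_eq_octahedralSix`, `dist_eq_cappedBipyramidSix`).
* *Enumeration*: if `#M ≤ 2`, a third use of "no `K₅`" makes `M` two disjoint pairs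
  (`twoK2_absurd`); so `contactNumber ≤ 12`. If `#M = 3`, relabel by a bijection `ι` sending
  `p ↦ {0,1}` and `q ↦ {2,3}` (case A, `q` disjoint from `p`) or `q ↦ {1,2}` (case B); the third
  pair becomes an arbitrary label pair `{a,b}` and `sixSpheres_caseA/B` run over the `36` values
  of `(a,b)`, each closed by a branch lemma applied along an explicit relabelling whose
  combinatorial side condition is checked by `decide`.

## References

* R. S. Hoy, J. Harwayne-Gidansky, C. S. O'Hern, Phys. Rev. E 85 (2012) 051403,
  arXiv:1202.5208, §II (p. 4, Fig. 1). [HoyHarwayneGidanskyOHern2012]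
* N. Arkus, V. N. Manoharan, M. P. Brenner, Phys. Rev. Lett. 103 (2009) 118303 (geometric rules:
  no `K₅`; at most two spheres touch three mutually touching spheres). [ArkusManoharanBrenner2009]
-/

noncomputable section

open Finset

namespace Literature.Barriers.AtomisticToContinuum

/-! ### Inner products from distances -/

/-- Polarisation: `⟪a - b, c - d⟫ = (|ad|² + |bc|² - |ac|² - |bd|²) / 2`. [folklore] -/
theorem inner_sub_sub_eq_dist (a b c d : (EuclideanSpace ℝ (Fin 3))) :
    inner ℝ (a - b) (c - d) = (dist a d ^ 2 + dist b c ^ 2 - dist a c ^ 2 - dist b d ^ 2) / 2 := by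
  rw [dist_eq_norm, dist_eq_norm, dist_eq_norm, dist_eq_norm, norm_sub_sq_real, norm_sub_sq_real,
    norm_sub_sq_real, norm_sub_sq_real, inner_sub_left, inner_sub_right, inner_sub_right]
  ring

/-- `⟪a - b, a - b⟫ = |ab|²`. [folklore] -/
theorem inner_sub_self_eq_dist_sq (a b : (EuclideanSpace ℝ (Fin 3))) : inner ℝ (a - b) (a - b) = dist a b ^ 2 := by
  rw [real_inner_self_eq_norm_sq, dist_eq_norm]

/-! ### Linear (in)dependence tools in `ℝ³` -/

/-- Two vectors with non-singular Gram matrix are linearly independent. [folklore] -/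
theorem linearIndependent_pair_of_gram {a b : (EuclideanSpace ℝ (Fin 3))}
    (h : inner ℝ a a * inner ℝ b b ≠ inner ℝ a b ^ 2) : LinearIndependent ℝ ![a, b] := by
  rw [LinearIndependent.pair_iff]
  intro s t hst
  have h1 : s * inner ℝ a a + t * inner ℝ a b = 0 := by
    have := congrArg (fun v => inner ℝ v a) hst
    simp only [inner_add_left, real_inner_smul_left, inner_zero_left] at this
    rw [real_inner_comm a b] at this
    exact this
  have h2 : s * inner ℝ a b + t * inner ℝ b b = 0 := by
    have := congrArg (fun v => inner ℝ v b) hst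
    simp only [inner_add_left, real_inner_smul_left, inner_zero_left] at this
    exact this
  have hd : inner ℝ a a * inner ℝ b b - inner ℝ a b ^ 2 ≠ 0 := sub_ne_zero.2 h
  have hs : s * (inner ℝ a a * inner ℝ b b - inner ℝ a b ^ 2) = 0 := by
    linear_combination (inner ℝ b b) * h1 - (inner ℝ a b) * h2
  have ht : t * (inner ℝ a a * inner ℝ b b - inner ℝ a b ^ 2) = 0 := by
    linear_combination (inner ℝ a a) * h2 - (inner ℝ a b) * h1
  exact ⟨(mul_eq_zero.1 hs).resolve_right hd, (mul_eq_zero.1 ht).resolve_right hd⟩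

/-- A nonzero vector orthogonal to every member of a family lies outside its span. [folklore] -/
theorem not_mem_span_of_inner_eq_zero {ι : Type*} {v : ι → (EuclideanSpace ℝ (Fin 3))} {x : (EuclideanSpace ℝ (Fin 3))} (hx : x ≠ 0)
    (h : ∀ i, inner ℝ x (v i) = 0) : x ∉ Submodule.span ℝ (Set.range v) := by
  intro hmem
  have hle : Submodule.span ℝ (Set.range v) ≤ (ℝ ∙ x)ᗮ := by
    rw [Submodule.span_le]
    rintro _ ⟨i, rfl⟩
    exact Submodule.mem_orthogonal_singleton_iff_inner_right.2 (h i)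
  have h0 : inner ℝ x x = 0 := Submodule.mem_orthogonal_singleton_iff_inner_right.1 (hle hmem)
  exact hx (inner_self_eq_zero.1 h0)

/-- In `ℝ³`, a vector orthogonal to three linearly independent vectors vanishes. [folklore] -/
theorem eq_zero_of_inner_three {v : Fin 3 → (EuclideanSpace ℝ (Fin 3))} (hv : LinearIndependent ℝ v) {x : (EuclideanSpace ℝ (Fin 3))}
    (h : ∀ i, inner ℝ x (v i) = 0) : x = 0 := by
  by_contra hx
  have hli : LinearIndependent ℝ (Fin.cons x v : Fin 4 → (EuclideanSpace ℝ (Fin 3))) :=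
    linearIndependent_finCons.2 ⟨hv, not_mem_span_of_inner_eq_zero hx h⟩
  have := hli.fintype_card_le_finrank
  rw [finrank_euclideanSpace_fin, Fintype.card_fin] at this
  omega

/-- An independent pair together with a nonzero vector orthogonal to both is independent.
[folklore] -/
theorem linearIndependent_three {a b n : (EuclideanSpace ℝ (Fin 3))} (hab : LinearIndependent ℝ ![a, b]) (hn : n ≠ 0)
    (ha : inner ℝ n a = 0) (hb : inner ℝ n b = 0) : LinearIndependent ℝ ![n, a, b] := by
  refine linearIndependent_finCons.2 ⟨hab, not_mem_span_of_inner_eq_zero hn ?_⟩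
  intro i
  fin_cases i
  · simpa using ha
  · simpa using hb

/-- Two vectors orthogonal to an independent pair in `ℝ³` are parallel. [folklore] -/
theorem exists_smul_of_inner_eq_zero {a b u u' : (EuclideanSpace ℝ (Fin 3))} (hab : LinearIndependent ℝ ![a, b])
    (hu : u ≠ 0) (hua : inner ℝ u a = 0) (hub : inner ℝ u b = 0) (hu'a : inner ℝ u' a = 0)
    (hu'b : inner ℝ u' b = 0) : ∃ t : ℝ, u' = t • u := by
  have huu : inner ℝ u u ≠ 0 := fun h => hu (inner_self_eq_zero.1 h)
  refine ⟨inner ℝ u' u / inner ℝ u u, ?_⟩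
  have h3 := linearIndependent_three hab hu hua hub
  have key : u' - (inner ℝ u' u / inner ℝ u u) • u = 0 := by
    refine eq_zero_of_inner_three h3 fun i => ?_
    fin_cases i
    · show inner ℝ (u' - (inner ℝ u' u / inner ℝ u u) • u) u = 0
      rw [inner_sub_left, real_inner_smul_left, div_mul_cancel₀ _ huu, sub_self]
    · simp [inner_sub_left, real_inner_smul_left, hua, hu'a]
    · simp [inner_sub_left, real_inner_smul_left, hub, hu'b]
  exact sub_eq_zero.1 key

/-! ### Three spheres, caps over a triangle -/

/-- **Three spheres meet in at most two points**: if `q₂ - q₁, q₃ - q₁` are independent (the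
centres are not collinear), no three distinct points are at distance `2` from all of
`q₁, q₂, q₃`. [folklore] -/
theorem three_spheres {q₁ q₂ q₃ y₁ y₂ y₃ : (EuclideanSpace ℝ (Fin 3))} (hq : LinearIndependent ℝ ![q₂ - q₁, q₃ - q₁])
    (h11 : dist y₁ q₁ = 2) (h12 : dist y₁ q₂ = 2) (h13 : dist y₁ q₃ = 2)
    (h21 : dist y₂ q₁ = 2) (h22 : dist y₂ q₂ = 2) (h23 : dist y₂ q₃ = 2)
    (h31 : dist y₃ q₁ = 2) (h32 : dist y₃ q₂ = 2) (h33 : dist y₃ q₃ = 2)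
    (hy12 : y₁ ≠ y₂) (hy13 : y₁ ≠ y₃) (hy23 : y₂ ≠ y₃) : False := by
  have hu0 : y₂ - y₁ ≠ 0 := sub_ne_zero.2 hy12.symm
  have hua : inner ℝ (y₂ - y₁) (q₂ - q₁) = 0 := by
    rw [inner_sub_sub_eq_dist, h21, h12, h22, h11]; norm_num
  have hub : inner ℝ (y₂ - y₁) (q₃ - q₁) = 0 := by
    rw [inner_sub_sub_eq_dist, h21, h13, h23, h11]; norm_num
  have hu'a : inner ℝ (y₃ - y₁) (q₂ - q₁) = 0 := by
    rw [inner_sub_sub_eq_dist, h31, h12, h32, h11]; norm_num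
  have hu'b : inner ℝ (y₃ - y₁) (q₃ - q₁) = 0 := by
    rw [inner_sub_sub_eq_dist, h31, h13, h33, h11]; norm_num
  obtain ⟨t, ht⟩ := exists_smul_of_inner_eq_zero hq hu0 hua hub hu'a hu'b
  -- the sphere about `q₁`
  have e1 : inner ℝ (y₁ - q₁) (y₁ - q₁) = 4 := by rw [inner_sub_self_eq_dist_sq, h11]; norm_num
  have e2 : inner ℝ (y₂ - q₁) (y₂ - q₁) = 4 := by rw [inner_sub_self_eq_dist_sq, h21]; norm_num
  have e3 : inner ℝ (y₃ - q₁) (y₃ - q₁) = 4 := by rw [inner_sub_self_eq_dist_sq, h31]; norm_num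
  have f2 : y₂ - q₁ = (y₁ - q₁) + (y₂ - y₁) := by abel
  have f3 : y₃ - q₁ = (y₁ - q₁) + t • (y₂ - y₁) := by rw [← ht]; abel
  rw [f2] at e2
  rw [f3] at e3
  simp only [inner_add_left, inner_add_right, real_inner_smul_left, real_inner_smul_right] at e2 e3
  rw [real_inner_comm (y₁ - q₁) (y₂ - y₁)] at e2 e3
  have huu : inner ℝ (y₂ - y₁) (y₂ - y₁) ≠ 0 := fun h => hu0 (inner_self_eq_zero.1 h)
  have key : (t * t - t) * inner ℝ (y₂ - y₁) (y₂ - y₁) = 0 := by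
    linear_combination e3 - t * e2 + (t - 1) * e1
  rcases mul_eq_zero.1 key with h | h
  · have : t * (t - 1) = 0 := by linear_combination h
    rcases mul_eq_zero.1 this with h0 | h1
    · rw [h0, zero_smul, sub_eq_zero] at ht
      exact hy13 ht.symm
    · have h1' : t = 1 := by linarith
      rw [h1', one_smul] at ht
      exact hy23 (by
        have := congrArg (· + y₁) ht
        simpa using this.symm)
  · exact huu h

/-- **Reflection lemma (vector form).** Over the equilateral triangle `0, a, b` of side `2`, two
distinct points `Y ≠ Y'` at distance `2` from its three vertices satisfy
`Y + Y' = (2/3)(a + b)` (they are mirror images in the plane of the triangle). [folklore] -/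
theorem cap_reflect_vec {a b Y Y' : (EuclideanSpace ℝ (Fin 3))} (haa : inner ℝ a a = 4) (hbb : inner ℝ b b = 4)
    (hab : inner ℝ a b = 2) (hYY : inner ℝ Y Y = 4) (hYa : inner ℝ Y a = 2) (hYb : inner ℝ Y b = 2)
    (hY'Y' : inner ℝ Y' Y' = 4) (hY'a : inner ℝ Y' a = 2) (hY'b : inner ℝ Y' b = 2)
    (hne : Y ≠ Y') : Y + Y' = (2 / 3 : ℝ) • (a + b) := by
  have hba : inner ℝ b a = 2 := by rw [real_inner_comm]; exact hab
  have hli : LinearIndependent ℝ ![a, b] :=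
    linearIndependent_pair_of_gram (by rw [haa, hbb, hab]; norm_num)
  have hu0 : Y' - Y ≠ 0 := sub_ne_zero.2 hne.symm
  have hua : inner ℝ (Y' - Y) a = 0 := by rw [inner_sub_left, hY'a, hYa, sub_self]
  have hub : inner ℝ (Y' - Y) b = 0 := by rw [inner_sub_left, hY'b, hYb, sub_self]
  have hu'a : inner ℝ (Y + Y' - (2 / 3 : ℝ) • (a + b)) a = 0 := by
    simp only [inner_sub_left, inner_add_left, real_inner_smul_left, hYa, hY'a, haa, hba]; norm_num
  have hu'b : inner ℝ (Y + Y' - (2 / 3 : ℝ) • (a + b)) b = 0 := by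
    simp only [inner_sub_left, inner_add_left, real_inner_smul_left, hYb, hY'b, hab, hbb]; norm_num
  obtain ⟨t, ht⟩ := exists_smul_of_inner_eq_zero hli hu0 hua hub hu'a hu'b
  have hYa' : inner ℝ a Y = 2 := by rw [real_inner_comm]; exact hYa
  have hYb' : inner ℝ b Y = 2 := by rw [real_inner_comm]; exact hYb
  have hY'a' : inner ℝ a Y' = 2 := by rw [real_inner_comm]; exact hY'a
  have hY'b' : inner ℝ b Y' = 2 := by rw [real_inner_comm]; exact hY'b
  have hu'u : inner ℝ (Y + Y' - (2 / 3 : ℝ) • (a + b)) (Y' - Y) = 0 := by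
    simp only [inner_sub_left, inner_add_left, real_inner_smul_left, inner_sub_right, hYY, hY'Y',
      hYa', hYb', hY'a', hY'b']
    rw [real_inner_comm Y Y']
    ring
  rw [ht, real_inner_smul_left] at hu'u
  have huu : inner ℝ (Y' - Y) (Y' - Y) ≠ 0 := fun h => hu0 (inner_self_eq_zero.1 h)
  have ht0 : t = 0 := (mul_eq_zero.1 hu'u).resolve_right huu
  rw [ht0, zero_smul, sub_eq_zero] at ht
  exact ht

/-- Squared distance of the two caps: `|Y - Y'|² = 32/3`. [folklore] -/
theorem cap_dist_vec {a b Y Y' : (EuclideanSpace ℝ (Fin 3))} (haa : inner ℝ a a = 4) (hbb : inner ℝ b b = 4)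
    (hab : inner ℝ a b = 2) (hYY : inner ℝ Y Y = 4) (hYa : inner ℝ Y a = 2) (hYb : inner ℝ Y b = 2)
    (hY'Y' : inner ℝ Y' Y' = 4) (hY'a : inner ℝ Y' a = 2) (hY'b : inner ℝ Y' b = 2)
    (hne : Y ≠ Y') : inner ℝ (Y - Y') (Y - Y') = 32 / 3 := by
  have h := cap_reflect_vec haa hbb hab hYY hYa hYb hY'Y' hY'a hY'b hne
  have hY' : Y' = (2 / 3 : ℝ) • (a + b) - Y := by rw [← h]; abel
  have hba : inner ℝ b a = 2 := by rw [real_inner_comm]; exact hab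
  have hYa' : inner ℝ a Y = 2 := by rw [real_inner_comm]; exact hYa
  have hYb' : inner ℝ b Y = 2 := by rw [real_inner_comm]; exact hYb
  rw [hY']
  simp only [inner_sub_left, inner_sub_right, inner_add_left, inner_add_right, real_inner_smul_left,
    real_inner_smul_right, haa, hbb, hab, hba, hYY, hYa, hYb, hYa', hYb']
  norm_num

/-- **Reflection lemma (point form).** Two distinct points `y ≠ y'` at distance `2` from the three
vertices of an equilateral triangle `p₁ p₂ p₃` of side `2` are mirror images in its plane:
`y + y' = (2/3)(p₁ + p₂ + p₃)`, and `|y y'|² = 32/3` (twice the height `2√(2/3)` of the regular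
tetrahedron of edge `2`). [folklore] -/
theorem cap_point {p₁ p₂ p₃ y y' : (EuclideanSpace ℝ (Fin 3))} (h12 : dist p₁ p₂ = 2) (h13 : dist p₁ p₃ = 2)
    (h23 : dist p₂ p₃ = 2) (hy1 : dist y p₁ = 2) (hy2 : dist y p₂ = 2) (hy3 : dist y p₃ = 2)
    (hy'1 : dist y' p₁ = 2) (hy'2 : dist y' p₂ = 2) (hy'3 : dist y' p₃ = 2) (hne : y ≠ y') :
    y + y' = (2 / 3 : ℝ) • (p₁ + p₂ + p₃) ∧ dist y y' ^ 2 = 32 / 3 := by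
  have haa : inner ℝ (p₂ - p₁) (p₂ - p₁) = 4 := by
    rw [inner_sub_self_eq_dist_sq, dist_comm, h12]; norm_num
  have hbb : inner ℝ (p₃ - p₁) (p₃ - p₁) = 4 := by
    rw [inner_sub_self_eq_dist_sq, dist_comm, h13]; norm_num
  have hab : inner ℝ (p₂ - p₁) (p₃ - p₁) = 2 := by
    rw [inner_sub_sub_eq_dist, dist_comm p₂ p₁, h12, h13, h23, dist_self]; norm_num
  have hYY : inner ℝ (y - p₁) (y - p₁) = 4 := by rw [inner_sub_self_eq_dist_sq, hy1]; norm_num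
  have hYa : inner ℝ (y - p₁) (p₂ - p₁) = 2 := by
    rw [inner_sub_sub_eq_dist, hy1, h12, hy2, dist_self]; norm_num
  have hYb : inner ℝ (y - p₁) (p₃ - p₁) = 2 := by
    rw [inner_sub_sub_eq_dist, hy1, h13, hy3, dist_self]; norm_num
  have hY'Y' : inner ℝ (y' - p₁) (y' - p₁) = 4 := by rw [inner_sub_self_eq_dist_sq, hy'1]; norm_num
  have hY'a : inner ℝ (y' - p₁) (p₂ - p₁) = 2 := by
    rw [inner_sub_sub_eq_dist, hy'1, h12, hy'2, dist_self]; norm_num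
  have hY'b : inner ℝ (y' - p₁) (p₃ - p₁) = 2 := by
    rw [inner_sub_sub_eq_dist, hy'1, h13, hy'3, dist_self]; norm_num
  have hne' : y - p₁ ≠ y' - p₁ := fun e => hne (sub_left_inj.1 e)
  refine ⟨?_, ?_⟩
  · have h := cap_reflect_vec haa hbb hab hYY hYa hYb hY'Y' hY'a hY'b hne'
    have e : y + y' = (y - p₁) + (y' - p₁) + (2 : ℝ) • p₁ := by module
    rw [e, h]
    module
  · have h := cap_dist_vec haa hbb hab hYY hYa hYb hY'Y' hY'a hY'b hne'
    rwa [sub_sub_sub_cancel_right, inner_sub_self_eq_dist_sq] at h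

/-! ### The five contact patterns on six labelled points

The patterns are given by explicit lists of CONTACT pairs `(i, j)`, `i < j` (inlined literally in
the statements below; no auxiliary definitions):

* octahedron: all pairs except the antipodes `(0,1), (2,3), (4,5)` (labelling of `octahedralSix`);
* capped trigonal bipyramid: all pairs except `(0,4), (0,5), (1,5)` (labelling of
  `cappedBipyramidSix`, Hoy et al. Fig. 1(b));
* "triangle": all pairs except `(0,1), (0,2), (1,2)`;
* "path plus edge": all pairs except `(0,1), (1,2), (3,4)`;
* "inside two disjoint pairs": all pairs except `(0,1), (2,3)`;

and the `20` ordered pairs of distinct labels of `Fin 5` for the `K₅` obstruction. -/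

/-- The explicit list of the `20` ordered pairs of distinct labels in `Fin 5` is complete.
[folklore] -/
theorem mem_pairs5 : ∀ i j : Fin 5, i ≠ j → (i, j) ∈ ([(0,1),(0,2),(0,3),(0,4),(1,0),(1,2),(1,3),(1,4),(2,0),(2,1),(2,3),(2,4), (3,0),(3,1),(3,2),(3,4),(4,0),(4,1),(4,2),(4,3)] : List (Fin 5 × Fin 5)) := by decide

/-- **Pattern "triangle" is impossible**: three distinct points cannot all touch the three
vertices of an equilateral triangle of side `2` (at most two spheres touch three mutually
touching spheres). [folklore] -/
theorem tri_absurd (v : Fin 6 → (EuclideanSpace ℝ (Fin 3))) (hv : Function.Injective v)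
    (hc : ∀ i j : Fin 6, (i, j) ∈ ([(0,3),(0,4),(0,5),(1,3),(1,4),(1,5),(2,3),(2,4),(2,5),(3,4),(3,5),(4,5)] : List (Fin 6 × Fin 6)) → dist (v i) (v j) = 2) : False := by
  have h03 := hc 0 3 (by decide); have h04 := hc 0 4 (by decide); have h05 := hc 0 5 (by decide)
  have h13 := hc 1 3 (by decide); have h14 := hc 1 4 (by decide); have h15 := hc 1 5 (by decide)
  have h23 := hc 2 3 (by decide); have h24 := hc 2 4 (by decide); have h25 := hc 2 5 (by decide)
  have h34 := hc 3 4 (by decide); have h35 := hc 3 5 (by decide); have h45 := hc 4 5 (by decide)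
  refine three_spheres (q₁ := v 3) (q₂ := v 4) (q₃ := v 5) (y₁ := v 0) (y₂ := v 1) (y₃ := v 2) ?_
    h03 h04 h05 h13 h14 h15 h23 h24 h25 (hv.ne (by decide)) (hv.ne (by decide)) (hv.ne (by decide))
  refine linearIndependent_pair_of_gram ?_
  rw [inner_sub_self_eq_dist_sq, inner_sub_self_eq_dist_sq, inner_sub_sub_eq_dist,
    dist_comm (v 4) (v 3), dist_comm (v 5) (v 3), h34, h35, h45, dist_self]
  norm_num

/-- **Pattern "path plus edge" is impossible**: with `5` touching everything, `3, 4` the two caps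
over the triangle `0 2 5`, the three distinct points `0, 1, 2` would all touch the non-collinear
`5, 3, 4`. [folklore] -/
theorem p3p2_absurd (v : Fin 6 → (EuclideanSpace ℝ (Fin 3))) (hv : Function.Injective v)
    (hc : ∀ i j : Fin 6, (i, j) ∈ ([(0,2),(0,3),(0,4),(0,5),(1,3),(1,4),(1,5),(2,3),(2,4),(2,5),(3,5),(4,5)] : List (Fin 6 × Fin 6)) → dist (v i) (v j) = 2) : False := by
  have h02 := hc 0 2 (by decide); have h03 := hc 0 3 (by decide); have h04 := hc 0 4 (by decide)
  have h05 := hc 0 5 (by decide); have h13 := hc 1 3 (by decide); have h14 := hc 1 4 (by decide)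
  have h15 := hc 1 5 (by decide); have h23 := hc 2 3 (by decide); have h24 := hc 2 4 (by decide)
  have h25 := hc 2 5 (by decide); have h35 := hc 3 5 (by decide); have h45 := hc 4 5 (by decide)
  have h30 : dist (v 3) (v 0) = 2 := (dist_comm _ _).trans h03
  have h32 : dist (v 3) (v 2) = 2 := (dist_comm _ _).trans h23
  have h40 : dist (v 4) (v 0) = 2 := (dist_comm _ _).trans h04
  have h42 : dist (v 4) (v 2) = 2 := (dist_comm _ _).trans h24
  have h54 : dist (v 5) (v 4) = 2 := (dist_comm _ _).trans h45
  obtain ⟨-, hde⟩ := cap_point h02 h05 h25 h30 h32 h35 h40 h42 h45 (hv.ne (by decide) : v 3 ≠ v 4)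
  refine three_spheres (q₁ := v 5) (q₂ := v 3) (q₃ := v 4) (y₁ := v 0) (y₂ := v 1) (y₃ := v 2) ?_
    h05 h03 h04 h15 h13 h14 h25 h23 h24 (hv.ne (by decide)) (hv.ne (by decide)) (hv.ne (by decide))
  refine linearIndependent_pair_of_gram ?_
  rw [inner_sub_self_eq_dist_sq, inner_sub_self_eq_dist_sq, inner_sub_sub_eq_dist, h35, h45, h54,
    hde, dist_self]
  norm_num

/-- **Pattern "at most two disjoint non-contacts" is impossible** (hence six balls never have
`13` contacts): with the regular tetrahedron `0 2 4 5`, the caps force `3 = cap(2)` over `0 4 5`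
and `1 = cap(0)` over `2 4 5`, whence `v 1 - v 3 = (5/3)(v 2 - v 0)` has length `10/3 ≠ 2`.
[folklore] -/
theorem twoK2_absurd (v : Fin 6 → (EuclideanSpace ℝ (Fin 3))) (hv : Function.Injective v)
    (hc : ∀ i j : Fin 6, (i, j) ∈ ([(0,2),(0,3),(0,4),(0,5),(1,2),(1,3),(1,4),(1,5),(2,4),(2,5),(3,4),(3,5),(4,5)] : List (Fin 6 × Fin 6)) → dist (v i) (v j) = 2) : False := by
  have h02 := hc 0 2 (by decide); have h04 := hc 0 4 (by decide)
  have h05 := hc 0 5 (by decide); have h12 := hc 1 2 (by decide); have h13 := hc 1 3 (by decide)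
  have h14 := hc 1 4 (by decide); have h15 := hc 1 5 (by decide); have h24 := hc 2 4 (by decide)
  have h25 := hc 2 5 (by decide); have h34 := hc 3 4 (by decide); have h35 := hc 3 5 (by decide)
  have h45 := hc 4 5 (by decide)
  have h20 : dist (v 2) (v 0) = 2 := (dist_comm _ _).trans h02
  have h30 : dist (v 3) (v 0) = 2 := (dist_comm _ _).trans (hc 0 3 (by decide))
  obtain ⟨e1, -⟩ := cap_point h04 h05 h45 h20 h24 h25 h30 h34 h35 (hv.ne (by decide) : v 2 ≠ v 3)
  obtain ⟨e2, -⟩ := cap_point h24 h25 h45 h02 h04 h05 h12 h14 h15 (hv.ne (by decide) : v 0 ≠ v 1)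
  have e : v 1 - v 3 = (5 / 3 : ℝ) • (v 2 - v 0) := by
    have : v 1 - v 3 = (v 0 + v 1) - (v 2 + v 3) + (v 2 - v 0) := by abel
    rw [this, e1, e2]
    module
  rw [dist_eq_norm, e, norm_smul, ← dist_eq_norm, h20, Real.norm_eq_abs,
    abs_of_pos (by norm_num : (0 : ℝ) < 5 / 3)] at h13
  norm_num at h13

/-- **Rigidity of the octahedral pattern**: if all pairs except `{0,1}, {2,3}, {4,5}` are contacts
(and these three pairs are pairs of distinct points), the three "axes" are pairwise orthogonal
with a common midpoint, and the three remaining squared distances are `8`. [folklore] -/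
theorem octa_sq_dists (v : Fin 6 → (EuclideanSpace ℝ (Fin 3))) (hv : Function.Injective v)
    (hc : ∀ i j : Fin 6, (i, j) ∈ ([(0,2),(0,3),(0,4),(0,5),(1,2),(1,3),(1,4),(1,5),(2,4),(2,5),(3,4),(3,5)] : List (Fin 6 × Fin 6)) → dist (v i) (v j) = 2) :
    dist (v 0) (v 1) ^ 2 = 8 ∧ dist (v 2) (v 3) ^ 2 = 8 ∧ dist (v 4) (v 5) ^ 2 = 8 := by
  have h02 := hc 0 2 (by decide); have h03 := hc 0 3 (by decide); have h04 := hc 0 4 (by decide)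
  have h05 := hc 0 5 (by decide); have h12 := hc 1 2 (by decide); have h13 := hc 1 3 (by decide)
  have h14 := hc 1 4 (by decide); have h15 := hc 1 5 (by decide); have h24 := hc 2 4 (by decide)
  have h25 := hc 2 5 (by decide); have h34 := hc 3 4 (by decide); have h35 := hc 3 5 (by decide)
  have h20 : dist (v 2) (v 0) = 2 := (dist_comm _ _).trans h02
  have h21 : dist (v 2) (v 1) = 2 := (dist_comm _ _).trans h12
  have h30 : dist (v 3) (v 0) = 2 := (dist_comm _ _).trans h03
  have h31 : dist (v 3) (v 1) = 2 := (dist_comm _ _).trans h13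
  have h40 : dist (v 4) (v 0) = 2 := (dist_comm _ _).trans h04
  have h41 : dist (v 4) (v 1) = 2 := (dist_comm _ _).trans h14
  have h50 : dist (v 5) (v 0) = 2 := (dist_comm _ _).trans h05
  have h51 : dist (v 5) (v 1) = 2 := (dist_comm _ _).trans h15
  have h42 : dist (v 4) (v 2) = 2 := (dist_comm _ _).trans h24
  have h43 : dist (v 4) (v 3) = 2 := (dist_comm _ _).trans h34
  have h52 : dist (v 5) (v 2) = 2 := (dist_comm _ _).trans h25
  have h53 : dist (v 5) (v 3) = 2 := (dist_comm _ _).trans h35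
  -- the three axes are pairwise orthogonal
  have hαγ : inner ℝ (v 1 - v 0) (v 3 - v 2) = 0 := by
    rw [inner_sub_sub_eq_dist, h12, h03, h13, h02]; norm_num
  have hαε : inner ℝ (v 1 - v 0) (v 5 - v 4) = 0 := by
    rw [inner_sub_sub_eq_dist, h14, h05, h15, h04]; norm_num
  have hγε : inner ℝ (v 3 - v 2) (v 5 - v 4) = 0 := by
    rw [inner_sub_sub_eq_dist, h34, h25, h35, h24]; norm_num
  have hγα : inner ℝ (v 3 - v 2) (v 1 - v 0) = 0 := by rw [real_inner_comm]; exact hαγ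
  have hεα : inner ℝ (v 5 - v 4) (v 1 - v 0) = 0 := by rw [real_inner_comm]; exact hαε
  have hεγ : inner ℝ (v 5 - v 4) (v 3 - v 2) = 0 := by rw [real_inner_comm]; exact hγε
  have hli : LinearIndependent ℝ ![v 1 - v 0, v 3 - v 2, v 5 - v 4] := by
    refine linearIndependent_of_ne_zero_of_inner_eq_zero (fun i => ?_) (fun i j hij => ?_)
    · fin_cases i
      · simpa [sub_eq_zero] using hv.ne (by decide)
      · simpa [sub_eq_zero] using hv.ne (by decide)
      · simpa [sub_eq_zero] using hv.ne (by decide)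
    · fin_cases i <;> fin_cases j <;> simp [hαγ, hγα, hαε, hεα, hγε, hεγ] at hij ⊢
  -- common midpoints
  have hδ : (v 0 + v 1) - (v 2 + v 3) = 0 := by
    have hrw : (v 0 + v 1) - (v 2 + v 3) = (v 0 - v 2) + (v 1 - v 3) := by abel
    rw [hrw]
    refine eq_zero_of_inner_three hli fun i => ?_
    fin_cases i
    · show inner ℝ ((v 0 - v 2) + (v 1 - v 3)) (v 1 - v 0) = 0
      rw [inner_add_left, inner_sub_sub_eq_dist, inner_sub_sub_eq_dist]
      simp only [dist_self, h21, h20, h31, h30, dist_comm (v 1) (v 0)]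
      ring
    · show inner ℝ ((v 0 - v 2) + (v 1 - v 3)) (v 3 - v 2) = 0
      rw [inner_add_left, inner_sub_sub_eq_dist, inner_sub_sub_eq_dist]
      simp only [dist_self, h02, h03, h12, h13, dist_comm (v 3) (v 2)]
      ring
    · show inner ℝ ((v 0 - v 2) + (v 1 - v 3)) (v 5 - v 4) = 0
      rw [inner_add_left, inner_sub_sub_eq_dist, inner_sub_sub_eq_dist]
      simp only [h04, h25, h05, h24, h14, h35, h15, h34]
      ring
  have hδ' : (v 0 + v 1) - (v 4 + v 5) = 0 := by
    have hrw : (v 0 + v 1) - (v 4 + v 5) = (v 0 - v 4) + (v 1 - v 5) := by abel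
    rw [hrw]
    refine eq_zero_of_inner_three hli fun i => ?_
    fin_cases i
    · show inner ℝ ((v 0 - v 4) + (v 1 - v 5)) (v 1 - v 0) = 0
      rw [inner_add_left, inner_sub_sub_eq_dist, inner_sub_sub_eq_dist]
      simp only [dist_self, h41, h40, h51, h50, dist_comm (v 1) (v 0)]
      ring
    · show inner ℝ ((v 0 - v 4) + (v 1 - v 5)) (v 3 - v 2) = 0
      rw [inner_add_left, inner_sub_sub_eq_dist, inner_sub_sub_eq_dist]
      simp only [h02, h43, h03, h42, h12, h53, h13, h52]
      ring
    · show inner ℝ ((v 0 - v 4) + (v 1 - v 5)) (v 5 - v 4) = 0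
      rw [inner_add_left, inner_sub_sub_eq_dist, inner_sub_sub_eq_dist]
      simp only [dist_self, h04, h05, h14, h15, dist_comm (v 5) (v 4)]
      ring
  -- Pythagoras on the three pairs of axes
  have e1 : (2 : ℝ) • (v 0 - v 2) = (v 3 - v 2) - (v 1 - v 0) + ((v 0 + v 1) - (v 2 + v 3)) := by
    module
  have e2 : (2 : ℝ) • (v 0 - v 4) = (v 5 - v 4) - (v 1 - v 0) + ((v 0 + v 1) - (v 4 + v 5)) := by
    module
  have e3 : (2 : ℝ) • (v 2 - v 4) =
      (v 5 - v 4) - (v 3 - v 2) + (((v 0 + v 1) - (v 4 + v 5)) - ((v 0 + v 1) - (v 2 + v 3))) := by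
    module
  rw [hδ, add_zero] at e1
  rw [hδ', add_zero] at e2
  rw [hδ, hδ', sub_zero, add_zero] at e3
  have n02 : inner ℝ (v 0 - v 2) (v 0 - v 2) = 4 := by rw [inner_sub_self_eq_dist_sq, h02]; norm_num
  have n04 : inner ℝ (v 0 - v 4) (v 0 - v 4) = 4 := by rw [inner_sub_self_eq_dist_sq, h04]; norm_num
  have n24 : inner ℝ (v 2 - v 4) (v 2 - v 4) = 4 := by rw [inner_sub_self_eq_dist_sq, h24]; norm_num
  have gα : inner ℝ (v 1 - v 0) (v 1 - v 0) = dist (v 0) (v 1) ^ 2 := by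
    rw [inner_sub_self_eq_dist_sq, dist_comm]
  have gγ : inner ℝ (v 3 - v 2) (v 3 - v 2) = dist (v 2) (v 3) ^ 2 := by
    rw [inner_sub_self_eq_dist_sq, dist_comm]
  have gε : inner ℝ (v 5 - v 4) (v 5 - v 4) = dist (v 4) (v 5) ^ 2 := by
    rw [inner_sub_self_eq_dist_sq, dist_comm]
  set α := v 1 - v 0 with hα
  set γ := v 3 - v 2 with hγ
  set ε := v 5 - v 4 with hε
  set d02 := v 0 - v 2 with hd02
  set d04 := v 0 - v 4 with hd04
  set d24 := v 2 - v 4 with hd24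
  have f1 := congrArg (fun x => inner ℝ x x) e1
  have f2 := congrArg (fun x => inner ℝ x x) e2
  have f3 := congrArg (fun x => inner ℝ x x) e3
  simp only [real_inner_smul_left, real_inner_smul_right, inner_sub_left, inner_sub_right,
    hαγ, hγα, hαε, hεα, hγε, hεγ, n02, n04, n24, gα, gγ, gε] at f1 f2 f3
  refine ⟨?_, ?_, ?_⟩ <;> linarith

/-- **The capped trigonal bipyramid pattern is rigid**: if all pairs except `{0,4}, {0,5}, {1,5}`
are contacts, then `|04|² = |15|² = 32/3` and `|05| = 10/3`. [folklore] -/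
theorem ctb_dists (v : Fin 6 → (EuclideanSpace ℝ (Fin 3))) (hv : Function.Injective v)
    (hc : ∀ i j : Fin 6, (i, j) ∈ ([(0,1),(0,2),(0,3),(1,2),(1,3),(1,4),(2,3),(2,4),(2,5),(3,4),(3,5),(4,5)] : List (Fin 6 × Fin 6)) → dist (v i) (v j) = 2) :
    dist (v 0) (v 4) ^ 2 = 32 / 3 ∧ dist (v 1) (v 5) ^ 2 = 32 / 3 ∧ dist (v 0) (v 5) = 10 / 3 := by
  have h01 := hc 0 1 (by decide); have h02 := hc 0 2 (by decide); have h03 := hc 0 3 (by decide)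
  have h12 := hc 1 2 (by decide); have h13 := hc 1 3 (by decide); have h14 := hc 1 4 (by decide)
  have h23 := hc 2 3 (by decide); have h24 := hc 2 4 (by decide); have h25 := hc 2 5 (by decide)
  have h34 := hc 3 4 (by decide); have h35 := hc 3 5 (by decide); have h45 := hc 4 5 (by decide)
  have h41 : dist (v 4) (v 1) = 2 := (dist_comm _ _).trans h14
  have h42 : dist (v 4) (v 2) = 2 := (dist_comm _ _).trans h24
  have h43 : dist (v 4) (v 3) = 2 := (dist_comm _ _).trans h34
  have h52 : dist (v 5) (v 2) = 2 := (dist_comm _ _).trans h25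
  have h53 : dist (v 5) (v 3) = 2 := (dist_comm _ _).trans h35
  have h54 : dist (v 5) (v 4) = 2 := (dist_comm _ _).trans h45
  obtain ⟨e1, d04⟩ := cap_point h12 h13 h23 h01 h02 h03 h41 h42 h43 (hv.ne (by decide) : v 0 ≠ v 4)
  obtain ⟨e2, d15⟩ := cap_point h23 h24 h34 h12 h13 h14 h52 h53 h54 (hv.ne (by decide) : v 1 ≠ v 5)
  refine ⟨d04, d15, ?_⟩
  have e : v 0 - v 5 = (5 / 3 : ℝ) • (v 1 - v 4) := by
    have : v 0 - v 5 = (v 0 + v 4) - (v 1 + v 5) + (v 1 - v 4) := by abel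
    rw [this, e1, e2]
    module
  rw [dist_eq_norm, e, norm_smul, ← dist_eq_norm, h14, Real.norm_eq_abs,
    abs_of_pos (by norm_num : (0 : ℝ) < 5 / 3)]
  norm_num

/-! ### From patterns to congruence with the two model clusters -/

open Literature.Geometry.DiscreteGeometry (sqNormInt)

/-- Squared distances in a scaled integer model at scale `2/√m`: `4 n_ij / m`. [folklore] -/
theorem dist_sq_intConfig {N : ℕ} (c : Fin N → Fin 3 → ℤ) {m : ℕ} (hm : 0 < m) (i j : Fin N) :
    dist (intConfig c (2 / Real.sqrt m) i) (intConfig c (2 / Real.sqrt m) j) ^ 2 =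
      4 * (sqNormInt (c i - c j) : ℝ) / m := by
  rw [dist_intConfig_sqrt c hm, mul_pow,
    Real.sq_sqrt (div_nonneg (sqNormInt_nonneg _) (Nat.cast_nonneg _))]
  ring

/-- Contact pairs of `octahedralSix` have integer squared distance `162`. [folklore] -/
theorem sqNormInt_octaContacts :
    ∀ i j : Fin 6, (i, j) ∈ ([(0,2),(0,3),(0,4),(0,5),(1,2),(1,3),(1,4),(1,5),(2,4),(2,5),(3,4),(3,5)] : List (Fin 6 × Fin 6)) → sqNormInt (octaInt i - octaInt j) = 162 := by
  decide +kernel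

/-- Contact pairs of `cappedBipyramidSix` have integer squared distance `162`. [folklore] -/
theorem sqNormInt_ctbContacts :
    ∀ i j : Fin 6, (i, j) ∈ ([(0,1),(0,2),(0,3),(1,2),(1,3),(1,4),(2,3),(2,4),(2,5),(3,4),(3,5),(4,5)] : List (Fin 6 × Fin 6)) → sqNormInt (ctbInt i - ctbInt j) = 162 := by
  decide +kernel

/-- Contacts of the octahedron from the integer table. [folklore] -/
theorem dist_octahedralSix_eq_two {i j : Fin 6} (h : sqNormInt (octaInt i - octaInt j) = 162) :
    dist (octahedralSix i) (octahedralSix j) = 2 := by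
  rw [octahedralSix, dist_intConfig_sqrt octaInt (by norm_num : 0 < 162), h]
  push_cast
  rw [div_self (by norm_num : (162 : ℝ) ≠ 0), Real.sqrt_one]
  ring

/-- The three antipodal squared distances of `octahedralSix` are `8`. [folklore] -/
theorem dist_sq_octahedralSix_antipodes :
    dist (octahedralSix 0) (octahedralSix 1) ^ 2 = 8 ∧ dist (octahedralSix 2) (octahedralSix 3) ^ 2 = 8 ∧
      dist (octahedralSix 4) (octahedralSix 5) ^ 2 = 8 := by
  have h01 : sqNormInt (octaInt 0 - octaInt 1) = 324 := by decide +kernel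
  have h23 : sqNormInt (octaInt 2 - octaInt 3) = 324 := by decide +kernel
  have h45 : sqNormInt (octaInt 4 - octaInt 5) = 324 := by decide +kernel
  simp only [octahedralSix, dist_sq_intConfig octaInt (by norm_num : 0 < 162), h01, h23, h45]
  norm_num

/-- The three non-contact distances of `cappedBipyramidSix`: `|04|² = |15|² = 32/3`,
`|05| = 10/3`. [folklore] -/
theorem dist_cappedBipyramidSix_nonContacts :
    dist (cappedBipyramidSix 0) (cappedBipyramidSix 4) ^ 2 = 32 / 3 ∧
      dist (cappedBipyramidSix 1) (cappedBipyramidSix 5) ^ 2 = 32 / 3 ∧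
        dist (cappedBipyramidSix 0) (cappedBipyramidSix 5) = 10 / 3 := by
  have h04 : sqNormInt (ctbInt 0 - ctbInt 4) = 432 := by decide +kernel
  have h15 : sqNormInt (ctbInt 1 - ctbInt 5) = 432 := by decide +kernel
  have h05 : sqNormInt (ctbInt 0 - ctbInt 5) = 450 := by decide +kernel
  refine ⟨?_, ?_, ?_⟩
  · rw [cappedBipyramidSix, dist_sq_intConfig ctbInt (by norm_num : 0 < 162), h04]; norm_num
  · rw [cappedBipyramidSix, dist_sq_intConfig ctbInt (by norm_num : 0 < 162), h15]; norm_num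
  · rw [cappedBipyramidSix, dist_intConfig_sqrt ctbInt (by norm_num : 0 < 162), h05]
    have : Real.sqrt (((450 : ℤ) : ℝ) / (162 : ℕ)) = 5 / 3 := by
      rw [Real.sqrt_eq_iff_mul_self_eq (by norm_num) (by norm_num)]; norm_num
    rw [this]; norm_num

/-- All pair distances agree once they agree for `i < j`. [folklore] -/
theorem dist_eq_of_lt {v v' : Fin 6 → (EuclideanSpace ℝ (Fin 3))}
    (h : ∀ i j : Fin 6, i < j → dist (v i) (v j) = dist (v' i) (v' j)) :
    ∀ i j : Fin 6, dist (v i) (v j) = dist (v' i) (v' j) := by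
  intro i j
  rcases lt_trichotomy i j with hij | rfl | hji
  · exact h i j hij
  · simp
  · rw [dist_comm (v i), dist_comm (v' i)]; exact h j i hji

/-- Equal squares of distances give equal distances. [folklore] -/
theorem dist_eq_of_sq_eq {a b c d : (EuclideanSpace ℝ (Fin 3))} (h : dist a b ^ 2 = dist c d ^ 2) : dist a b = dist c d :=
  (pow_left_inj₀ dist_nonneg dist_nonneg two_ne_zero).1 h

/-- **A six-point configuration with the octahedral contact pattern is congruent, label by label,
to `octahedralSix`.** [folklore] -/
theorem dist_eq_octahedralSix (v : Fin 6 → (EuclideanSpace ℝ (Fin 3))) (hv : Function.Injective v)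
    (hc : ∀ i j : Fin 6, (i, j) ∈ ([(0,2),(0,3),(0,4),(0,5),(1,2),(1,3),(1,4),(1,5),(2,4),(2,5),(3,4),(3,5)] : List (Fin 6 × Fin 6)) → dist (v i) (v j) = 2) :
    ∀ i j : Fin 6, dist (v i) (v j) = dist (octahedralSix i) (octahedralSix j) := by
  obtain ⟨d01, d23, d45⟩ := octa_sq_dists v hv hc
  obtain ⟨o01, o23, o45⟩ := dist_sq_octahedralSix_antipodes
  have hcon : ∀ i j : Fin 6, (i, j) ∈ ([(0,2),(0,3),(0,4),(0,5),(1,2),(1,3),(1,4),(1,5),(2,4),(2,5),(3,4),(3,5)] : List (Fin 6 × Fin 6)) →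
      dist (v i) (v j) = dist (octahedralSix i) (octahedralSix j) := fun i j h => by
    rw [hc i j h, dist_octahedralSix_eq_two (sqNormInt_octaContacts i j h)]
  refine dist_eq_of_lt fun i j hij => ?_
  fin_cases i <;> fin_cases j <;> first
    | exact absurd hij (by decide)
    | exact hcon _ _ (by decide)
    | exact dist_eq_of_sq_eq (d01.trans o01.symm)
    | exact dist_eq_of_sq_eq (d23.trans o23.symm)
    | exact dist_eq_of_sq_eq (d45.trans o45.symm)

/-- **A six-point configuration with the capped-bipyramid contact pattern is congruent, label by
label, to `cappedBipyramidSix`.** [folklore] -/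
theorem dist_eq_cappedBipyramidSix (v : Fin 6 → (EuclideanSpace ℝ (Fin 3))) (hv : Function.Injective v)
    (hc : ∀ i j : Fin 6, (i, j) ∈ ([(0,1),(0,2),(0,3),(1,2),(1,3),(1,4),(2,3),(2,4),(2,5),(3,4),(3,5),(4,5)] : List (Fin 6 × Fin 6)) → dist (v i) (v j) = 2) :
    ∀ i j : Fin 6, dist (v i) (v j) = dist (cappedBipyramidSix i) (cappedBipyramidSix j) := by
  obtain ⟨d04, d15, d05⟩ := ctb_dists v hv hc
  obtain ⟨o04, o15, o05⟩ := dist_cappedBipyramidSix_nonContacts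
  have hcon : ∀ i j : Fin 6, (i, j) ∈ ([(0,1),(0,2),(0,3),(1,2),(1,3),(1,4),(2,3),(2,4),(2,5),(3,4),(3,5),(4,5)] : List (Fin 6 × Fin 6)) →
      dist (v i) (v j) = dist (cappedBipyramidSix i) (cappedBipyramidSix j) := fun i j h => by
    rw [hc i j h, dist_cappedBipyramidSix_eq_two (sqNormInt_ctbContacts i j h)]
  refine dist_eq_of_lt fun i j hij => ?_
  fin_cases i <;> fin_cases j <;> first
    | exact absurd hij (by decide)
    | exact hcon _ _ (by decide)
    | exact dist_eq_of_sq_eq (d04.trans o04.symm)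
    | exact dist_eq_of_sq_eq (d15.trans o15.symm)
    | exact d05.trans o05.symm

/-- Relabelling a cluster by a bijection of the labels does not change its congruence class up to
relabelling. [folklore] -/
theorem IsRelabelledCongruent.of_comp {z X : Fin 6 → (EuclideanSpace ℝ (Fin 3))} (ι : Fin 6 → Fin 6)
    (hι : Function.Injective ι) (h : IsRelabelledCongruent (z ∘ ι) X) : IsRelabelledCongruent z X := by
  rw [isRelabelledCongruent_iff] at h ⊢
  obtain ⟨σ, hσ⟩ := h
  set τ : Equiv.Perm (Fin 6) := Equiv.ofBijective ι (Finite.injective_iff_bijective.1 hι) with hτ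
  refine ⟨τ.symm.trans σ, fun i j => ?_⟩
  have hi : ι (τ.symm i) = i := τ.apply_symm_apply i
  have hj : ι (τ.symm j) = j := τ.apply_symm_apply j
  have := hσ (τ.symm i) (τ.symm j)
  simp only [Function.comp_apply, hi, hj] at this
  simpa using this

/-! ### Branch lemmas: a complete description of the non-contacts by label pairs -/

/-- If every non-contact pair of distinct labels satisfies `P`, then along an injective relabelling
`π` every listed pair violating `P` is a contact. [folklore] -/
theorem contacts_of_complete {w : Fin 6 → (EuclideanSpace ℝ (Fin 3))} {P : Fin 6 → Fin 6 → Prop}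
    (hcomp : ∀ i j, i ≠ j → dist (w i) (w j) ≠ 2 → P i j) {k : ℕ} (π : Fin k → Fin 6)
    (hπ : Function.Injective π) (L : List (Fin k × Fin k))
    (hL : ∀ e ∈ L, e.1 ≠ e.2 ∧ ¬ P (π e.1) (π e.2)) :
    ∀ i j, (i, j) ∈ L → dist ((w ∘ π) i) ((w ∘ π) j) = 2 := by
  intro i j hij
  obtain ⟨hne, hP⟩ := hL (i, j) hij
  by_contra hd
  exact hP (hcomp _ _ (hπ.ne hne) hd)

/-- Branch "five mutually touching balls": impossible. [folklore] -/
theorem k5_branch (w : Fin 6 → (EuclideanSpace ℝ (Fin 3))) (P : Fin 6 → Fin 6 → Prop)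
    (hcomp : ∀ i j, i ≠ j → dist (w i) (w j) ≠ 2 → P i j) (π : Fin 5 → Fin 6)
    (hπ : Function.Injective π ∧ ∀ e ∈ ([(0,1),(0,2),(0,3),(0,4),(1,0),(1,2),(1,3),(1,4),(2,0),(2,1),(2,3),(2,4), (3,0),(3,1),(3,2),(3,4),(4,0),(4,1),(4,2),(4,3)] : List (Fin 5 × Fin 5)), e.1 ≠ e.2 ∧ ¬ P (π e.1) (π e.2)) : False :=
  no_five_pairwise_dist_two (w ∘ π) fun i j hij =>
    contacts_of_complete hcomp π hπ.1
      ([(0,1),(0,2),(0,3),(0,4),(1,0),(1,2),(1,3),(1,4),(2,0),(2,1),(2,3),(2,4), (3,0),(3,1),(3,2),(3,4),(4,0),(4,1),(4,2),(4,3)] : List (Fin 5 × Fin 5)) hπ.2 i j (mem_pairs5 i j hij)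

/-- Branch "non-contacts inside two disjoint pairs": impossible. [folklore] -/
theorem twoK2_branch (w : Fin 6 → (EuclideanSpace ℝ (Fin 3))) (hw : Function.Injective w) (P : Fin 6 → Fin 6 → Prop)
    (hcomp : ∀ i j, i ≠ j → dist (w i) (w j) ≠ 2 → P i j) (π : Fin 6 → Fin 6)
    (hπ : Function.Injective π ∧ ∀ e ∈ ([(0,2),(0,3),(0,4),(0,5),(1,2),(1,3),(1,4),(1,5),(2,4),(2,5),(3,4),(3,5),(4,5)] : List (Fin 6 × Fin 6)), e.1 ≠ e.2 ∧ ¬ P (π e.1) (π e.2)) : False :=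
  twoK2_absurd (w ∘ π) (hw.comp hπ.1) (contacts_of_complete hcomp π hπ.1 _ hπ.2)

/-- Branch "non-contacts form a triangle": impossible. [folklore] -/
theorem tri_branch (w : Fin 6 → (EuclideanSpace ℝ (Fin 3))) (hw : Function.Injective w) (P : Fin 6 → Fin 6 → Prop)
    (hcomp : ∀ i j, i ≠ j → dist (w i) (w j) ≠ 2 → P i j) (π : Fin 6 → Fin 6)
    (hπ : Function.Injective π ∧ ∀ e ∈ ([(0,3),(0,4),(0,5),(1,3),(1,4),(1,5),(2,3),(2,4),(2,5),(3,4),(3,5),(4,5)] : List (Fin 6 × Fin 6)), e.1 ≠ e.2 ∧ ¬ P (π e.1) (π e.2)) : False :=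
  tri_absurd (w ∘ π) (hw.comp hπ.1) (contacts_of_complete hcomp π hπ.1 _ hπ.2)

/-- Branch "non-contacts form a path plus an edge": impossible. [folklore] -/
theorem p3p2_branch (w : Fin 6 → (EuclideanSpace ℝ (Fin 3))) (hw : Function.Injective w) (P : Fin 6 → Fin 6 → Prop)
    (hcomp : ∀ i j, i ≠ j → dist (w i) (w j) ≠ 2 → P i j) (π : Fin 6 → Fin 6)
    (hπ : Function.Injective π ∧ ∀ e ∈ ([(0,2),(0,3),(0,4),(0,5),(1,3),(1,4),(1,5),(2,3),(2,4),(2,5),(3,5),(4,5)] : List (Fin 6 × Fin 6)), e.1 ≠ e.2 ∧ ¬ P (π e.1) (π e.2)) : False :=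
  p3p2_absurd (w ∘ π) (hw.comp hπ.1) (contacts_of_complete hcomp π hπ.1 _ hπ.2)

/-- Branch "non-contacts form a perfect matching": the octahedron. [folklore] -/
theorem octa_branch (w : Fin 6 → (EuclideanSpace ℝ (Fin 3))) (hw : Function.Injective w) (P : Fin 6 → Fin 6 → Prop)
    (hcomp : ∀ i j, i ≠ j → dist (w i) (w j) ≠ 2 → P i j) (π : Fin 6 → Fin 6)
    (hπ : Function.Injective π ∧ ∀ e ∈ ([(0,2),(0,3),(0,4),(0,5),(1,2),(1,3),(1,4),(1,5),(2,4),(2,5),(3,4),(3,5)] : List (Fin 6 × Fin 6)), e.1 ≠ e.2 ∧ ¬ P (π e.1) (π e.2)) :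
    IsRelabelledCongruent w octahedralSix :=
  IsRelabelledCongruent.of_comp π hπ.1 <| (isRelabelledCongruent_iff _ _).2
    ⟨Equiv.refl _, dist_eq_octahedralSix (w ∘ π) (hw.comp hπ.1)
      (contacts_of_complete hcomp π hπ.1 _ hπ.2)⟩

/-- Branch "non-contacts form a path with three edges": the capped trigonal bipyramid.
[folklore] -/
theorem ctb_branch (w : Fin 6 → (EuclideanSpace ℝ (Fin 3))) (hw : Function.Injective w) (P : Fin 6 → Fin 6 → Prop)
    (hcomp : ∀ i j, i ≠ j → dist (w i) (w j) ≠ 2 → P i j) (π : Fin 6 → Fin 6)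
    (hπ : Function.Injective π ∧ ∀ e ∈ ([(0,1),(0,2),(0,3),(1,2),(1,3),(1,4),(2,3),(2,4),(2,5),(3,4),(3,5),(4,5)] : List (Fin 6 × Fin 6)), e.1 ≠ e.2 ∧ ¬ P (π e.1) (π e.2)) :
    IsRelabelledCongruent w cappedBipyramidSix :=
  IsRelabelledCongruent.of_comp π hπ.1 <| (isRelabelledCongruent_iff _ _).2
    ⟨Equiv.refl _, dist_eq_cappedBipyramidSix (w ∘ π) (hw.comp hπ.1)
      (contacts_of_complete hcomp π hπ.1 _ hπ.2)⟩

/-! ### The two relabelled cases: non-contacts `{0,1}, {2,3}, {a,b}` or `{0,1}, {1,2}, {a,b}` -/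

/-- **Case A** (two disjoint non-contact pairs `{0,1}, {2,3}` and a third pair `{a,b}`, possibly
degenerate): the cluster is the octahedron or the capped trigonal bipyramid. The `36` label cases
are dispatched to the branch lemmas with explicit relabellings. [folklore] -/
theorem sixSpheres_caseA (w : Fin 6 → (EuclideanSpace ℝ (Fin 3))) (hw : Function.Injective w) :
    ∀ a b : Fin 6, (∀ i j, i ≠ j → dist (w i) (w j) ≠ 2 →
      (i = 0 ∧ j = 1 ∨ i = 1 ∧ j = 0) ∨ (i = 2 ∧ j = 3 ∨ i = 3 ∧ j = 2) ∨ (i = a ∧ j = b ∨ i = b ∧ j = a)) →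
      IsRelabelledCongruent w octahedralSix ∨ IsRelabelledCongruent w cappedBipyramidSix := by
  intro a b
  fin_cases a <;> fin_cases b <;> intro hcomp
  all_goals first
    | exact (twoK2_branch w hw _ hcomp ![0, 1, 2, 3, 4, 5] (by decide)).elim
    | exact Or.inl (octa_branch w hw _ hcomp ![0, 1, 2, 3, 4, 5] (by decide))
    | exact Or.inr (ctb_branch w hw _ hcomp ![0, 3, 4, 5, 1, 2] (by decide))
    | exact Or.inr (ctb_branch w hw _ hcomp ![0, 2, 4, 5, 1, 3] (by decide))
    | exact Or.inr (ctb_branch w hw _ hcomp ![1, 3, 4, 5, 0, 2] (by decide))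
    | exact Or.inr (ctb_branch w hw _ hcomp ![1, 2, 4, 5, 0, 3] (by decide))
    | exact (p3p2_branch w hw _ hcomp ![1, 0, 4, 2, 3, 5] (by decide)).elim
    | exact (p3p2_branch w hw _ hcomp ![1, 0, 5, 2, 3, 4] (by decide)).elim
    | exact (p3p2_branch w hw _ hcomp ![0, 1, 4, 2, 3, 5] (by decide)).elim
    | exact (p3p2_branch w hw _ hcomp ![0, 1, 5, 2, 3, 4] (by decide)).elim
    | exact (p3p2_branch w hw _ hcomp ![3, 2, 4, 0, 1, 5] (by decide)).elim
    | exact (p3p2_branch w hw _ hcomp ![3, 2, 5, 0, 1, 4] (by decide)).elim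
    | exact (p3p2_branch w hw _ hcomp ![2, 3, 4, 0, 1, 5] (by decide)).elim
    | exact (p3p2_branch w hw _ hcomp ![2, 3, 5, 0, 1, 4] (by decide)).elim

/-- **Case B** (two non-contact pairs `{0,1}, {1,2}` sharing a label and a third pair `{a,b}`,
possibly degenerate): the cluster is the capped trigonal bipyramid (the other shapes — a star,
a triangle, a path plus an edge — are impossible). [folklore] -/
theorem sixSpheres_caseB (w : Fin 6 → (EuclideanSpace ℝ (Fin 3))) (hw : Function.Injective w) :
    ∀ a b : Fin 6, (∀ i j, i ≠ j → dist (w i) (w j) ≠ 2 →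
      (i = 0 ∧ j = 1 ∨ i = 1 ∧ j = 0) ∨ (i = 1 ∧ j = 2 ∨ i = 2 ∧ j = 1) ∨ (i = a ∧ j = b ∨ i = b ∧ j = a)) →
      IsRelabelledCongruent w octahedralSix ∨ IsRelabelledCongruent w cappedBipyramidSix := by
  intro a b
  fin_cases a <;> fin_cases b <;> intro hcomp
  all_goals first
    | exact (k5_branch w _ hcomp ![0, 2, 3, 4, 5] (by decide)).elim
    | exact (tri_branch w hw _ hcomp ![0, 1, 2, 3, 4, 5] (by decide)).elim
    | exact Or.inr (ctb_branch w hw _ hcomp ![1, 3, 4, 5, 2, 0] (by decide))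
    | exact Or.inr (ctb_branch w hw _ hcomp ![1, 4, 3, 5, 2, 0] (by decide))
    | exact Or.inr (ctb_branch w hw _ hcomp ![1, 5, 3, 4, 2, 0] (by decide))
    | exact Or.inr (ctb_branch w hw _ hcomp ![1, 3, 4, 5, 0, 2] (by decide))
    | exact Or.inr (ctb_branch w hw _ hcomp ![1, 4, 3, 5, 0, 2] (by decide))
    | exact Or.inr (ctb_branch w hw _ hcomp ![1, 5, 3, 4, 0, 2] (by decide))
    | exact (p3p2_branch w hw _ hcomp ![0, 1, 2, 3, 4, 5] (by decide)).elim
    | exact (p3p2_branch w hw _ hcomp ![0, 1, 2, 3, 5, 4] (by decide)).elim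
    | exact (p3p2_branch w hw _ hcomp ![0, 1, 2, 4, 5, 3] (by decide)).elim

/-! ### Combinatorial plumbing for the enumeration -/

/-- Two labels outside any four given labels. [folklore] -/
theorem exists_two_outside (a b c d : Fin 6) :
    ∃ e f : Fin 6, e ≠ f ∧ e ∉ ({a, b, c, d} : Finset (Fin 6)) ∧ f ∉ ({a, b, c, d} : Finset (Fin 6)) := by
  have hc : 1 < (univ \ ({a, b, c, d} : Finset (Fin 6))).card := by
    rw [Finset.card_univ_sdiff, Fintype.card_fin]
    have := Finset.card_le_four (a := a) (b := b) (c := c) (d := d)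
    omega
  obtain ⟨e, he, f, hf, hef⟩ := Finset.one_lt_card.1 hc
  exact ⟨e, f, hef, (Finset.mem_sdiff.1 he).2, (Finset.mem_sdiff.1 hf).2⟩

/-- Three labels outside any three given labels. [folklore] -/
theorem exists_three_outside (a b c : Fin 6) :
    ∃ d e f : Fin 6, d ≠ e ∧ d ≠ f ∧ e ≠ f ∧ d ∉ ({a, b, c} : Finset (Fin 6)) ∧
      e ∉ ({a, b, c} : Finset (Fin 6)) ∧ f ∉ ({a, b, c} : Finset (Fin 6)) := by
  have hc : 2 < (univ \ ({a, b, c} : Finset (Fin 6))).card := by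
    rw [Finset.card_univ_sdiff, Fintype.card_fin]
    have := Finset.card_le_three (a := a) (b := b) (c := c)
    omega
  obtain ⟨d, hd, e, he, f, hf, hde, hdf, hef⟩ := Finset.two_lt_card.1 hc
  exact ⟨d, e, f, hde, hdf, hef, (Finset.mem_sdiff.1 hd).2, (Finset.mem_sdiff.1 he).2,
    (Finset.mem_sdiff.1 hf).2⟩

/-- Six pairwise distinct labels give a bijective relabelling. [folklore] -/
theorem injective_vec6 {a b c d e f : Fin 6}
    (h : a ≠ b ∧ a ≠ c ∧ a ≠ d ∧ a ≠ e ∧ a ≠ f ∧ b ≠ c ∧ b ≠ d ∧ b ≠ e ∧ b ≠ f ∧ c ≠ d ∧ c ≠ e ∧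
      c ≠ f ∧ d ≠ e ∧ d ≠ f ∧ e ≠ f) :
    Function.Injective ![a, b, c, d, e, f] := by
  intro i j hij
  fin_cases i <;> fin_cases j <;> simp at hij ⊢ <;> omega

/-- Transport of a complete list of non-contact pairs along a relabelling `ι`: if every
non-contact pair of `z` is (as an unordered pair) one of `{ι a₁, ι b₁}, {ι a₂, ι b₂}, {ι a₃, ι b₃}`,
then every non-contact label pair of `z ∘ ι` is one of `{a₁,b₁}, {a₂,b₂}, {a₃,b₃}`. [folklore] -/
theorem complete_relabel {z : Fin 6 → (EuclideanSpace ℝ (Fin 3))} {M : Finset (Fin 6 × Fin 6)}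
    (hNC : ∀ x y : Fin 6, x ≠ y → dist (z x) (z y) ≠ 2 → (x, y) ∈ M ∨ (y, x) ∈ M)
    (ι : Fin 6 → Fin 6) (hι : Function.Injective ι) {a₁ b₁ a₂ b₂ a₃ b₃ : Fin 6}
    (hM : ∀ t ∈ M, (t.1 = ι a₁ ∧ t.2 = ι b₁ ∨ t.1 = ι b₁ ∧ t.2 = ι a₁) ∨ (t.1 = ι a₂ ∧ t.2 = ι b₂ ∨ t.1 = ι b₂ ∧ t.2 = ι a₂) ∨
      (t.1 = ι a₃ ∧ t.2 = ι b₃ ∨ t.1 = ι b₃ ∧ t.2 = ι a₃)) :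
    ∀ i j : Fin 6, i ≠ j → dist ((z ∘ ι) i) ((z ∘ ι) j) ≠ 2 →
      (i = a₁ ∧ j = b₁ ∨ i = b₁ ∧ j = a₁) ∨ (i = a₂ ∧ j = b₂ ∨ i = b₂ ∧ j = a₂) ∨ (i = a₃ ∧ j = b₃ ∨ i = b₃ ∧ j = a₃) := by
  have key : ∀ {x y a b : Fin 6}, (ι x = ι a ∧ ι y = ι b ∨ ι x = ι b ∧ ι y = ι a) → (x = a ∧ y = b ∨ x = b ∧ y = a) := by
    intro x y a b h
    rcases h with ⟨h1, h2⟩ | ⟨h1, h2⟩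
    · exact Or.inl ⟨hι h1, hι h2⟩
    · exact Or.inr ⟨hι h1, hι h2⟩
  have key' : ∀ {x y a b : Fin 6}, (ι y = ι a ∧ ι x = ι b ∨ ι y = ι b ∧ ι x = ι a) → (x = a ∧ y = b ∨ x = b ∧ y = a) := by
    intro x y a b h
    rcases h with ⟨h1, h2⟩ | ⟨h1, h2⟩
    · exact Or.inr ⟨hι h2, hι h1⟩
    · exact Or.inl ⟨hι h2, hι h1⟩
  intro i j hij hd
  rcases hNC _ _ (hι.ne hij) hd with h | h
  · rcases hM _ h with h' | h' | h'
    exacts [Or.inl (key h'), Or.inr (Or.inl (key h')), Or.inr (Or.inr (key h'))]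
  · rcases hM _ h with h' | h' | h'
    exacts [Or.inl (key' h'), Or.inr (Or.inl (key' h')), Or.inr (Or.inr (key' h'))]

/-! ### The enumeration theorem -/

/-- **Discharge of the named fact `ArkusHoy_sixSpheres`** (Hoy–Harwayne-Gidansky–O'Hern:
"`M(6,12) = 2` since exactly two six-particle macrostates exist for systems with
`N_c = N_c^max(6) = 12`", obtained there by exact enumeration): among six distinct points of `ℝ³`
at most `12` pairs are at distance `2`, and `12` such pairs force congruence (up to relabelling)
with the octahedron or with the capped trigonal bipyramid. The proof is an independent elementary
one: no five balls touch pairwise, so every label is avoided by some non-contact pair; the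
non-contact pairs are then two disjoint pairs plus a third (case A) or two pairs through a common
label plus a third (case B), and the relabelled cases are `sixSpheres_caseA/B`. The packing and
minimal-rigidity hypotheses of the fact are not needed.
[cite: HoyHarwayneGidanskyOHern2012, §II (p. 4, "M(6,12) = 2 … N_c^max(6) = 12", Fig. 1)] -/
theorem ArkusHoy_sixSpheres_holds : ArkusHoy_sixSpheres := by
  intro z hz _hp _h3
  classical
  -- contact and non-contact pairs
  set P : Finset (Fin 6 × Fin 6) :=
    (univ : Finset (Fin 6 × Fin 6)).filter fun p => p.1 < p.2 ∧ dist (z p.1) (z p.2) = 2 with hP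
  set M : Finset (Fin 6 × Fin 6) :=
    (univ : Finset (Fin 6 × Fin 6)).filter fun p => p.1 < p.2 ∧ dist (z p.1) (z p.2) ≠ 2 with hM
  have hcn : contactNumber z = P.card := by
    unfold contactNumber; congr 1
  have h15 : P.card + M.card = 15 := by
    have h1 : P = ((univ : Finset (Fin 6 × Fin 6)).filter fun p => p.1 < p.2).filter
        fun p => dist (z p.1) (z p.2) = 2 := by rw [Finset.filter_filter]
    have h2 : M = ((univ : Finset (Fin 6 × Fin 6)).filter fun p => p.1 < p.2).filter
        fun p => ¬ dist (z p.1) (z p.2) = 2 := by rw [Finset.filter_filter]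
    rw [h1, h2, Finset.card_filter_add_card_filter_not]
    decide
  have hmemM : ∀ {t : Fin 6 × Fin 6}, t ∈ M ↔ t.1 < t.2 ∧ dist (z t.1) (z t.2) ≠ 2 := by
    intro t; simp [hM]
  -- no five balls touch pairwise: every label is avoided by a non-contact pair
  have hK5 : ∀ v : Fin 6, ∃ t ∈ M, t.1 ≠ v ∧ t.2 ≠ v := by
    intro v
    by_contra hcon
    push Not at hcon
    have hall : ∀ a b : Fin 6, a < b → a ≠ v → b ≠ v → dist (z a) (z b) = 2 := by
      intro a b hab ha hb
      by_contra hd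
      exact hb (hcon (a, b) (hmemM.2 ⟨hab, hd⟩) ha)
    refine no_five_pairwise_dist_two (fun k => z (v.succAbove k)) fun j k hjk => ?_
    have hne : v.succAbove j ≠ v.succAbove k := fun e => hjk (Fin.succAbove_right_injective e)
    rcases lt_or_gt_of_ne hne with hlt | hgt
    · exact hall _ _ hlt (Fin.succAbove_ne v j) (Fin.succAbove_ne v k)
    · rw [dist_comm]; exact hall _ _ hgt (Fin.succAbove_ne v k) (Fin.succAbove_ne v j)
  have hNC : ∀ x y : Fin 6, x ≠ y → dist (z x) (z y) ≠ 2 → (x, y) ∈ M ∨ (y, x) ∈ M := by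
    intro x y hxy hd
    rcases lt_or_gt_of_ne hxy with h | h
    · exact Or.inl (hmemM.2 ⟨h, hd⟩)
    · exact Or.inr (hmemM.2 ⟨h, fun h' => hd (by rwa [dist_comm] at h')⟩)
  -- two non-contact pairs `p`, `q`, with `q` avoiding `p.1`
  obtain ⟨p, hpM, -⟩ := hK5 0
  have hp12 : p.1 < p.2 := (hmemM.1 hpM).1
  obtain ⟨q, hqM, hq1, hq2⟩ := hK5 p.1
  have hq12 : q.1 < q.2 := (hmemM.1 hqM).1
  have hpq : p ≠ q := by rintro rfl; exact hq1 rfl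
  -- relabelling when `q` is disjoint from `p`
  have build : q.1 ≠ p.2 → q.2 ≠ p.2 → ∃ ι : Fin 6 → Fin 6, Function.Injective ι ∧
      ι 0 = p.1 ∧ ι 1 = p.2 ∧ ι 2 = q.1 ∧ ι 3 = q.2 := by
    intro h1 h2
    obtain ⟨e, f, hef, he, hf⟩ := exists_two_outside p.1 p.2 q.1 q.2
    simp only [Finset.mem_insert, Finset.mem_singleton, not_or] at he hf
    refine ⟨![p.1, p.2, q.1, q.2, e, f], injective_vec6 ?_, rfl, rfl, rfl, rfl⟩
    omega
  -- Part 1: at least three non-contact pairs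
  have h3 : 3 ≤ M.card := by
    by_contra hlt
    push Not at hlt
    obtain ⟨r, hrM, hr1, hr2⟩ := hK5 p.2
    have hsub : ({p, q} : Finset (Fin 6 × Fin 6)) ⊆ M := by
      simp [Finset.insert_subset_iff, hpM, hqM]
    have hMeq : M = {p, q} := by
      symm
      apply Finset.eq_of_subset_of_card_le hsub
      rw [Finset.card_pair hpq]
      omega
    have hrq : r = q := by
      have hr : r ∈ ({p, q} : Finset (Fin 6 × Fin 6)) := hMeq ▸ hrM
      simp only [Finset.mem_insert, Finset.mem_singleton] at hr
      rcases hr with rfl | rfl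
      · exact absurd rfl hr2
      · rfl
    subst hrq
    obtain ⟨ι, hι, h0, h1, h2, h3⟩ := build hr1 hr2
    have hcompl : ∀ t ∈ M, (t.1 = ι 0 ∧ t.2 = ι 1 ∨ t.1 = ι 1 ∧ t.2 = ι 0) ∨ (t.1 = ι 2 ∧ t.2 = ι 3 ∨ t.1 = ι 3 ∧ t.2 = ι 2) ∨
        (t.1 = ι 2 ∧ t.2 = ι 3 ∨ t.1 = ι 3 ∧ t.2 = ι 2) := by
      intro t ht
      rw [hMeq] at ht
      simp only [Finset.mem_insert, Finset.mem_singleton] at ht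
      rcases ht with rfl | rfl
      · exact Or.inl (Or.inl ⟨h0.symm, h1.symm⟩)
      · exact Or.inr (Or.inl (Or.inl ⟨h2.symm, h3.symm⟩))
    exact twoK2_branch (z ∘ ι) (hz.comp hι) _ (complete_relabel hNC ι hι hcompl)
      ![0, 1, 2, 3, 4, 5] (by decide)
  refine ⟨by omega, fun h12 => ?_⟩
  -- Part 2: exactly three non-contact pairs `p`, `q`, `s`
  have hM3 : M.card = 3 := by omega
  obtain ⟨s, hsM, hsp, hsq⟩ : ∃ s ∈ M, s ≠ p ∧ s ≠ q := by
    by_contra hcon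
    push Not at hcon
    have hsub : M ⊆ {p, q} := by
      intro t ht
      by_cases htp : t = p
      · simp [htp]
      · simp [hcon t ht htp]
    have := Finset.card_le_card hsub
    rw [Finset.card_pair hpq] at this
    omega
  have hMeq : ∀ t ∈ M, t = p ∨ t = q ∨ t = s := by
    have hsub : ({p, q, s} : Finset (Fin 6 × Fin 6)) ⊆ M := by
      simp [Finset.insert_subset_iff, hpM, hqM, hsM]
    have hE : ({p, q, s} : Finset (Fin 6 × Fin 6)) = M :=
      Finset.eq_of_subset_of_card_le hsub
        (by rw [hM3, Finset.card_eq_three.2 ⟨p, q, s, hpq, hsp.symm, hsq.symm, rfl⟩])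
    intro t ht
    rw [← hE] at ht
    simpa using ht
  have hs12 : s.1 < s.2 := (hmemM.1 hsM).1
  by_cases hdis : q.1 ≠ p.2 ∧ q.2 ≠ p.2
  · -- Case A: `q` disjoint from `p`
    obtain ⟨ι, hι, h0, h1, h2, h3'⟩ := build hdis.1 hdis.2
    obtain ⟨a, ha⟩ := Finite.surjective_of_injective hι s.1
    obtain ⟨b, hb⟩ := Finite.surjective_of_injective hι s.2
    have hcompl : ∀ t ∈ M, (t.1 = ι 0 ∧ t.2 = ι 1 ∨ t.1 = ι 1 ∧ t.2 = ι 0) ∨ (t.1 = ι 2 ∧ t.2 = ι 3 ∨ t.1 = ι 3 ∧ t.2 = ι 2) ∨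
        (t.1 = ι a ∧ t.2 = ι b ∨ t.1 = ι b ∧ t.2 = ι a) := by
      intro t ht
      rcases hMeq t ht with rfl | rfl | rfl
      · exact Or.inl (Or.inl ⟨h0.symm, h1.symm⟩)
      · exact Or.inr (Or.inl (Or.inl ⟨h2.symm, h3'.symm⟩))
      · exact Or.inr (Or.inr (Or.inl ⟨ha.symm, hb.symm⟩))
    rcases sixSpheres_caseA (z ∘ ι) (hz.comp hι) a b (complete_relabel hNC ι hι hcompl) with h | h
    · exact Or.inl (h.of_comp ι hι)
    · exact Or.inr (h.of_comp ι hι)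
  · -- Case B: `q` contains `p.2`; let `x` be its other label
    obtain ⟨x, hqx, hx1, hx2⟩ : ∃ x : Fin 6, (q = (p.2, x) ∨ q = (x, p.2)) ∧ x ≠ p.1 ∧ x ≠ p.2 := by
      rw [not_and_or] at hdis
      push Not at hdis
      rcases hdis with h | h
      · exact ⟨q.2, Or.inl (Prod.ext h rfl), hq2, by omega⟩
      · exact ⟨q.1, Or.inr (Prod.ext rfl h), hq1, by omega⟩
    obtain ⟨d, e, f, hde, hdf, hef, hd, he, hf⟩ := exists_three_outside p.1 p.2 x
    simp only [Finset.mem_insert, Finset.mem_singleton, not_or] at hd he hf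
    have hι : Function.Injective ![p.1, p.2, x, d, e, f] := injective_vec6 (by omega)
    set ι : Fin 6 → Fin 6 := ![p.1, p.2, x, d, e, f] with hιdef
    obtain ⟨a, ha⟩ := Finite.surjective_of_injective hι s.1
    obtain ⟨b, hb⟩ := Finite.surjective_of_injective hι s.2
    have h0 : ι 0 = p.1 := rfl
    have h1 : ι 1 = p.2 := rfl
    have h2 : ι 2 = x := rfl
    have hcompl : ∀ t ∈ M, (t.1 = ι 0 ∧ t.2 = ι 1 ∨ t.1 = ι 1 ∧ t.2 = ι 0) ∨ (t.1 = ι 1 ∧ t.2 = ι 2 ∨ t.1 = ι 2 ∧ t.2 = ι 1) ∨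
        (t.1 = ι a ∧ t.2 = ι b ∨ t.1 = ι b ∧ t.2 = ι a) := by
      intro t ht
      rcases hMeq t ht with rfl | rfl | rfl
      · exact Or.inl (Or.inl ⟨h0.symm, h1.symm⟩)
      · rcases hqx with h | h
        · exact Or.inr (Or.inl (Or.inl
            ⟨(congrArg Prod.fst h).trans h1.symm, (congrArg Prod.snd h).trans h2.symm⟩))
        · exact Or.inr (Or.inl (Or.inr
            ⟨(congrArg Prod.fst h).trans h2.symm, (congrArg Prod.snd h).trans h1.symm⟩))
      · exact Or.inr (Or.inr (Or.inl ⟨ha.symm, hb.symm⟩))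
    rcases sixSpheres_caseB (z ∘ ι) (hz.comp hι) a b (complete_relabel hNC ι hι hcompl) with h | h
    · exact Or.inl (h.of_comp ι hι)
    · exact Or.inr (h.of_comp ι hι)

end Literature.Barriers.AtomisticToContinuum

end
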